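import Summits.AnomalousDissipation.AnomalousDissipation.Theorems.BaireTransferDenseLoudLerayHopfForcesTrajectories

/-!
# Certificate `cert_denseLoudLerayHopfForces_of_loudTrajectories` of the line `ergodic-budget-selection-closing`
# (crux `BaireTransfer.DenseLoudDesignerForces`, stmt-AnomalousDissipation-1143)

Sorry-free discharge of the registered CERTIFICATE stub `cert_denseLoudLerayHopfForces_of_loudTrajectories` of the lead's
skeleton (`Cruxes/DenseLoudDesignerForces/Lines/ergodic_budget_selection_closing.lean`, v10).  It SIZES the line's physics
residual Stub 1′ `stub_denseLoudHyperbolicTrajectories`: the residual WITHOUT its hyperbolicity clause (H) — "for every stock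
`S₀` some `S ⊇ S₀`, budgets `E`, `ε > 0` and a non-empty open `U ⊆ P_S` in which, at every level `j`, the forces `c` are dense
whose steady designer force `f_c = force S c` admits, at some `ν ∈ (0, 1/(j+1))`, an NS phase `(K, φ)` (`IsNSPhase`: compact
forward-invariant set of smooth states of `H`, trajectories = global classical NS_ν(f_c) solutions on `[0, ∞)`) with ONE LOUD
TRAJECTORY `x ∈ K`, i.e. eventually `energyAvg φ x T ≤ E` and frequently `dissipAvg ν φ x T ≥ ε`" — already implies the
route's open support item `DenseLoudLerayHopfForces` (stmt-AnomalousDissipation-1149: dense forces carrying a GLOBAL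
LERAY–HOPF solution `u` from some datum with `meanEnergy u ≤ E` and `ε ≤ meanDissipation ν u`), with the SAME `(S, E, ε, U)`.

**Proof.**  All the mathematics is the landed trajectory dictionary of
`Theorems/BaireTransferDenseLoudLerayHopfForcesTrajectories.lean` (namespace `…Theorems.DenseLoudLerayHopfForces`): the
classical trajectory `(u, p)` of a loud point `x ∈ K` (`IsNSPhase.trajectory`) is a global Leray–Hopf solution from its
time-zero slice `u 0` (classical ⇒ Leray–Hopf on the convex time set `[0, ∞)`, Robinson–Rodrigo–Sadowski 2016 Thm. 6.5, in
the tree as `IsClassicalNSSolutionOn.isLerayHopfOn_of_convex`), and its `limsup` functionals `meanEnergy u`,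
`meanDissipation ν u` (Doering–Foias 2002 §2) ARE the `limsup`s of the trajectory means `energyAvg φ x`, `dissipAvg ν φ x`
(`‖φ_t x‖² = ∫‖u(t)‖²`; the spectral enstrophy only sees the a.e.-class); the dissipation means are bounded on a compact
phase, so eventually `energyAvg ≤ E` gives `meanEnergy u ≤ E` and frequently `dissipAvg ≥ ε` gives `ε ≤ meanDissipation ν u`
(`exists_isGlobalLerayHopf_of_loudTrajectory`).  Hence the level-`j` loud-trajectory set lies in the Leray–Hopf loud set
`lhLoudSet S E ε j` (`loudTrajectorySet_subset_lhLoudSet`), and the item — `denseLoudLerayHopfForces_iff`, definitional —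
follows level by level by `closure_mono` (`denseLoudLerayHopfForces_of_denseLoudTrajectories`).  This file re-exports these
facts under the REGISTERED certificate names in the line's namespace `…Theorems.DenseLoudDesignerForces.Ergodic`, once for
the H-free residual (the registered stub, last) and once for Stub 1′ verbatim (hyperbolicity clause dropped); it introduces
no definition and closes no item.  The converse-direction certificate `cert_loudTrajectory_of_periodicWitness` is a sibling
file of the line.

References: C. R. Doering, C. Foias, *Energy dissipation in body-forced turbulence*, J. Fluid Mech. 467 (2002) §2;
J. C. Robinson, J. L. Rodrigo, W. Sadowski, *The Three-Dimensional Navier–Stokes Equations* (CUP 2016) Thm. 6.5;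
Foias–Manley–Rosa–Temam, *Navier–Stokes Equations and Turbulence* (CUP 2001) Ch. IV §2 (time vs ensemble averages);
the route file `Theses/BaireTransfer.lean` (items 1143, 1149).
-/

-- `Summit.<Summit>.<Problem>` is the tree's mandated summit-side namespace (CONVENTIONS §2); for this
-- single-conjunct summit the two coincide, so the duplicate is deliberate.
set_option linter.dupNamespace false

noncomputable section

open scoped BigOperators Topology ENNReal InnerProductSpace
open Filter Set Function MeasureTheory

namespace Summit.AnomalousDissipation.AnomalousDissipation.Theorems.DenseLoudDesignerForces.Ergodic

open Literature.Analysis.FunctionSpaces Literature.Analysis.FunctionSpaces.Torus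
open Literature.Analysis.FluidPDE Literature.Analysis.FluidPDE.Torus
open Summit.AnomalousDissipation.AnomalousDissipation.Theses.BaireTransfer
open Summit.AnomalousDissipation.AnomalousDissipation.Theorems.DenseLoudDesignerForces.Negative
open Summit.AnomalousDissipation.AnomalousDissipation.Theorems.DenseLoudLerayHopfForces

/-! ## The level-`j` inclusion for Stub 1′ verbatim: inside the Leray–Hopf loud set (same budgets)

The H-free inclusion is the landed `loudTrajectorySet_subset_lhLoudSet` (imported, not restated). -/

/-- **Level-`j` certificate inclusion, Stub 1′ verbatim.**  The level-`j` set of Stub 1′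
`stub_denseLoudHyperbolicTrajectories` (loud trajectory + the chaotic hypothesis (H) on the loud invariant probability
measures carried by the closure of its forward orbit) lies in `lhLoudSet S E ε j` with the same budgets: drop (H), then the
landed H-free inclusion `loudTrajectorySet_subset_lhLoudSet` (the classical trajectory of the loud point is the Leray–Hopf
witness, `exists_isGlobalLerayHopf_of_loudTrajectory`). -/
theorem certLH_hypLoudTrajectorySet_subset_lhLoudSet (S : Finset (Fin 3 → ℤ)) (E ε : ℝ) (j : ℕ) :
    {c : ↥S → (EuclideanSpace ℂ (Fin 3)) | ∃ ν : ℝ, 0 < ν ∧ ν < 1 / ((j : ℝ) + 1) ∧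
        ∃ (K : Set Hsp) (φ : ℝ → Hsp → Hsp), IsNSPhase ν (force S c) K φ ∧
          ∃ x ∈ K, (∀ᶠ T in atTop, energyAvg φ x T ≤ E) ∧ (∃ᶠ T in atTop, ε ≤ dissipAvg ν φ x T) ∧
            ∀ μ : Measure Hsp, IsInvariantMeasure (closure ((fun t : ℝ => φ t x) '' Ici 0)) φ μ →
              ensembleEnergy μ ≤ E → ε ≤ ensembleDissipation ν μ → IsHyperbolicMeasure ν (force S c) φ μ} ⊆
      lhLoudSet S E ε j := by
  rintro c ⟨ν, hν, hνj, K, φ, hK, x, hx, hE, hε, -⟩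
  exact loudTrajectorySet_subset_lhLoudSet S E ε j ⟨ν, hν, hνj, K, φ, hK, x, hx, hE, hε⟩

/-! ## The certificates: the residual (with or without (H)) implies `DenseLoudLerayHopfForces` -/

/-- **Certificate, Stub 1′ verbatim ⇒ `DenseLoudLerayHopfForces`.**  The registered signature of the line's physics
residual `stub_denseLoudHyperbolicTrajectories` (skeleton v10), taken as hypothesis, implies the open support item
stmt-AnomalousDissipation-1149 with the same `(S, E, ε, U)`: unfold the item (`denseLoudLerayHopfForces_iff`, definitional)
and use `closure_mono` on `certLH_hypLoudTrajectorySet_subset_lhLoudSet` level by level; the hyperbolicity clause is not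
used (equivalently: `denseLoudLerayHopfForces_of_denseLoudHyperbolicTrajectories'`). -/
theorem cert_denseLoudLerayHopfForces_of_hyperbolicLoudTrajectories :
    (∀ S₀ : Finset (Fin 3 → ℤ), ∃ S : Finset (Fin 3 → ℤ), S₀ ⊆ S ∧ ∃ (E ε : ℝ), 0 < ε ∧
      ∃ U : Set (↥S → (EuclideanSpace ℂ (Fin 3))), IsOpen U ∧ U.Nonempty ∧ ∀ j : ℕ,
        U ⊆ closure {c : ↥S → (EuclideanSpace ℂ (Fin 3)) | ∃ ν : ℝ, 0 < ν ∧ ν < 1 / ((j : ℝ) + 1) ∧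
          ∃ (K : Set Hsp) (φ : ℝ → Hsp → Hsp), IsNSPhase ν (force S c) K φ ∧
            ∃ x ∈ K, (∀ᶠ T in atTop, energyAvg φ x T ≤ E) ∧ (∃ᶠ T in atTop, ε ≤ dissipAvg ν φ x T) ∧
              ∀ μ : Measure Hsp, IsInvariantMeasure (closure ((fun t : ℝ => φ t x) '' Ici 0)) φ μ →
                ensembleEnergy μ ≤ E → ε ≤ ensembleDissipation ν μ → IsHyperbolicMeasure ν (force S c) φ μ}) →
    DenseLoudLerayHopfForces := by
  intro h
  refine denseLoudLerayHopfForces_iff.2 fun S₀ => ?_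
  obtain ⟨S, hS, E, ε, hε, U, hUo, hUne, hU⟩ := h S₀
  exact ⟨S, hS, E, ε, hε, U, hUo, hUne, fun j =>
    (hU j).trans (closure_mono (certLH_hypLoudTrajectorySet_subset_lhLoudSet S E ε j))⟩

/-- **Registered certificate stub `cert_denseLoudLerayHopfForces_of_loudTrajectories` (line
`ergodic-budget-selection-closing`, crux stmt-AnomalousDissipation-1143): the H-free residual ⇒ `DenseLoudLerayHopfForces`.**
If for every finite stock `S₀` there are `S ⊇ S₀`, budgets `E`, `ε > 0` and a non-empty open `U ⊆ P_S` in which, at every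
level `j`, the forces carrying an NS phase of NS_ν(f_c) with a loud trajectory (eventually `energyAvg ≤ E`, frequently
`dissipAvg ≥ ε`) at some `ν ∈ (0, 1/(j+1))` are dense, then `DenseLoudLerayHopfForces` (stmt-AnomalousDissipation-1149)
holds with the same `(S, E, ε, U)`: unfold the item (`denseLoudLerayHopfForces_iff`) and apply `closure_mono` to
the landed inclusion `loudTrajectorySet_subset_lhLoudSet` level by level (equivalently: the landed
`denseLoudLerayHopfForces_of_denseLoudTrajectories`).  Doering–Foias 2002 §2 functionals; Robinson–Rodrigo–Sadowski 2016
Thm. 6.5 for classical ⇒ Leray–Hopf. -/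
theorem cert_denseLoudLerayHopfForces_of_loudTrajectories : (∀ S₀ : Finset (Fin 3 → ℤ), ∃ S : Finset (Fin 3 → ℤ), S₀ ⊆ S ∧ ∃ (E ε : ℝ), 0 < ε ∧ ∃ U : Set (↥S → (EuclideanSpace ℂ (Fin 3))), IsOpen U ∧ U.Nonempty ∧ ∀ j : ℕ, U ⊆ closure {c : ↥S → (EuclideanSpace ℂ (Fin 3)) | ∃ ν : ℝ, 0 < ν ∧ ν < 1 / ((j : ℝ) + 1) ∧ ∃ (K : Set Hsp) (φ : ℝ → Hsp → Hsp), IsNSPhase ν (force S c) K φ ∧ ∃ x ∈ K, (∀ᶠ T in atTop, energyAvg φ x T ≤ E) ∧ (∃ᶠ T in atTop, ε ≤ dissipAvg ν φ x T)}) → DenseLoudLerayHopfForces := by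
  intro h
  refine denseLoudLerayHopfForces_iff.2 fun S₀ => ?_
  obtain ⟨S, hS, E, ε, hε, U, hUo, hUne, hU⟩ := h S₀
  exact ⟨S, hS, E, ε, hε, U, hUo, hUne, fun j =>
    (hU j).trans (closure_mono (loudTrajectorySet_subset_lhLoudSet S E ε j))⟩

end Summit.AnomalousDissipation.AnomalousDissipation.Theorems.DenseLoudDesignerForces.Ergodic

end
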